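import Summits.BirchSwinnertonDyer.Rank1Residual.Supersingular.KuriharaTwistRoundingSchema
import Literature.NumberTheory.EllipticCurves.PAdicLFunctionIntegralityAtTwoProofs
import Literature.NumberTheory.EllipticCurves.PAdicLFunctionNeZeroProofs
import Literature.NumberTheory.EllipticCurves.SupersingularDensitySerreFrobeniusProofs
import Literature.NumberTheory.EllipticCurves.NewformsRealCoefficients
import HarnessLib

/-!
# Kurihara numbers from twisted `L`-values — the DENOMINATOR LEMMA of the rounding certificates
# as a tree theorem (`f`-units, Hasse-bounded; no Manin constant, no torsion, no optimality)

Cell `b2b-bsdres` (BSD rank `≤ 1` residual classes), supersingular family, prover A = unit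
`b2b-bsdres-x10b` (gen 10).  Topic file under `Summits/BirchSwinnertonDyer/Rank1Residual/Supersingular/`;
namespace `Summit.BirchSwinnertonDyer.Rank1Residual.Supersingular.KuriharaTwist` (that of
`TwistRecord` / `RoundingCert`).  THEOREMS ONLY; no named fact,
nothing asserted about any elliptic curve, nothing booked; marks unchanged.

HONEST FRAMING (run/shared/lean/b2b/bsd-rank1-residual/, verbatim in every file): the goal of the
cell is to DELETE the COMBINATION-SHAPED residual classes of the Birch–Swinnerton-Dyer formula for
ALL analytic-rank `≤ 1` elliptic curves over `ℚ` — "full BSD formula for every rank `≤ 1` curve in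
class `C`" assembled STRICTLY from published theorems — so that the rank-`≤ 1` remainder becomes
exactly the CONSTRUCTION-SHAPED classes, which are TYPED (missing-input `Prop`s), NOT attempted.
This is not "finishing BSD".

## What this file proves (referee-3 R3.339 (ii); harvest-1 2026-08-21T08:56Z)

The rounding certificates of `KuriharaTwistRoundingSchema.lean` (`RoundingCert`; the `certR_…` rows of
`Supersingular/*KuriharaTwistRounding*.lean`) turn a BALL `mid_k ± rad_k ∋ D'·C_k` of the twisted-`L`-value
engine into the EXACT integer `D'·C_k = J_k`; the step "`D'·C_k` is an integer" rested on a lemma ARGUED IN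
THE SCHEMA DOCSTRING (`2·c·#E(ℚ)_tors · x⁺{∞,a/n} ∈ ℤ`), with the Manin constant `c` and Cremona's optimality
code as data, and referee 3 (R3.339 (ii)) asked for it to be a DECLARATION.  In the units of the tree's own
symbol `[r]⁺_f = ratPlusSymbol f r` (period `Ω⁺_f` of `Λ_f`; the symbol inside the tree's `kuriharaNumber`)
it is one — sharper and hypothesis-free:

* `den_sum_ratPlusSymbol_dvd` — for ANY weight-2 cusp form `f` on `Γ₀(N)` with real coefficients, an
  Eisenstein multiple `n₀{∞,0}_f ∈ Λ_f` (`n₀ ≠ 0`) and `gcd(n, N) = 1`: every `ℤ`-linear combination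
  `x = Σ_i w_i [a_i/n]⁺_f` has `den x ∣ 2|n₀|` (tree: `exists_ratPlusSymbol_eq_div_two` — Manin's
  `{∞,a/n} ≡ {∞,0} (mod Λ_f)` and `re Λ_f = (Ω⁺_f/2)ℤ`).
* `den_sum_ratPlusSymbol_dvd_two_mul_reductionPointCount` — for the newform `f` of an elliptic curve
  `E = W/ℚ` (`IsNewformOf W f`) and ANY prime `ℓ ∤ N` of good reduction: `den x ∣ 2·#Ẽ(𝔽_ℓ)`
  (`n₀ = a_ℓ − ℓ − 1 = −#Ẽ(𝔽_ℓ)`: `sub_mul_modularSymbol_zero_mem_periodLattice` = Cremona (2.8.8),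
  `cuspCoeff_eq_frobeniusTrace_of_isNewformOf_holds`, `not_dvd_level_of_isNewformOf`).  No Manin
  constant, no `#E(ℚ)_tors`, no optimality: the curve enters only through `a_ℓ(f) = a_ℓ(E)`.
* `reductionPointCount_le_four_mul` — Hasse (`frobeniusTrace_sq_le_four_mul`): `#Ẽ(𝔽_ℓ) ≤ 4ℓ`.
* `mul_eq_of_abs_sub_lt` (ROUNDING LEMMA) — a rational `x` with `den x ∣ M` and `|D·x − J| < 1/M`
  (`D ∈ ℕ`, `J ∈ ℤ`) has `D·x = J`; `abs_sub_lt_of_ball` — the ball form: `|D·x − mid| ≤ rad`,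
  `|mid − J| ≤ mar`, `M·(mar + rad) < 1` give `|D·x − J| < 1/M` (all real numbers).
* `sum_ratPlusSymbol_eq_div_of_ball` (THE CERTIFICATE'S SOUNDNESS, `f`-units) — newform of `E`, good
  prime `ℓ ∤ N`, `gcd(n, N) = 1`, a ball `|D·x − mid| ≤ rad` around `D·x`, `x = Σ_i w_i[a_i/n]⁺_f`, an
  integer `J` with `|mid − J| ≤ mar`, and the HASSE-BOUNDED CERTIFICATE INEQUALITY `8ℓ·(mar + rad) < 1`
  ⟹ `x = J/D` EXACTLY.  (`den(D·x − J) ∣ den x ∣ 2#Ẽ(𝔽_ℓ) ≤ 8ℓ`, so a non-zero `D·x − J` has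
  absolute value `≥ 1/(8ℓ)`.)  With `ℓ = p` itself (good by the class predicate) the inequality is
  `8p·(mar + rad) < 1`; every one of the 3 775 landed certificate rows (files `KuriharaTwistRoundingP01–P41`,
  2 148 `certR`/`certR3` theorems, `p ≤ 113`) satisfies it with room to spare: `max 8p·(mar + rad) =
  1.13·10⁻⁵` (`405042dd1` @ `113`, `n = 123397`), `max (mar + rad) = 1.25·10⁻⁸` (re-read from the tree,
  2026-08-21, seat folder `work/validhasse_scan.txt`).
* `RoundingCert.sum_ratPlusSymbol_eq_div_of_ineq` — a `RoundingCert` row read in this currency: its recorded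
  decimal bounds with `8·p·(marNum·10^radExp + radNum·10^marExp) < 10^(marExp+radExp)` (`hcert_of_ineq`) and
  the ball give `x = J/D`; the fields `torsion`/`manin`/`optimality` are not read.  The decidable per-row
  check `RoundingCert.validHasse` (the schema's `valid` with `2·c·t ∣ D'` dropped and the inequality
  sharpened to this one) is the sibling `KuriharaTwistRoundingHasseCheck.lean`.

## What stays OUTSIDE the kernel (said plainly)

(a) The ball itself: that the engine's `mid_k ± rad_k` (Arb, rigorous series tail) contains the real number
it names — job evidence, as before (R135.4 clause (i)).  (b) WHICH real number it names: the engine evaluates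
`D'·C_k = D'·c_∞·Σ_{a ∈ bin k} Re{∞,a/n}/(c_∞ω₁)`, `ω₁` the least positive real period of the curve's Néron
lattice `Λ_E`; this is `D'·c_∞·Σ_{a∈bin k}[a/n]⁺_f` — the theorem's `D·x` with `D = D'·c_∞` — exactly when
`Ω⁺_f = c_∞·ω₁`, i.e. `Λ_f = Λ_E` (optimal curve, Manin constant `1`): the PERIOD-TRANSFER binder every `certL`
consumer already lists (`ModularParametrizationData`, `exists_rat_mul_realPeriodRat_eq_plusPeriod`).  So the
Manin constant and the optimality code have left the INTEGRALITY step (now a theorem) and live only in the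
period identification, where they always were.  (c) The identification of the bins with the tree's
`kuriharaNumber` (bins-to-`δ̃`: n1011-p09's `KuriharaTwistIdentity*.lean`; the Hecke distribution relation
of `ratPlusSymbol` at the level primes remains the lane's standing engine↔tree identification).

References: REFEREE-3.md R3.339; REFEREE.md R125.3 / R135.4; INBOX 2026-08-21T08:56Z (harvest seat 1 GEN 27);
Manin, Izv. 1972, Prop. 1.4, Thm. 1.6, §3; Cremona, *Algorithms for modular elliptic curves* (1997) §2.8
(2.8.7)–(2.8.9); Wiersema–Wuthrich, Doc. Math. 27 (2022) §2 Lemma 4 [WiersemaWuthrich2022]; C.-H. Kim,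
arXiv:2203.12159 §1.4 [Kim2022StructureSelmer]; HOME/b2b-bsdres-x10b/X6-KURIHARA.md §10.
-/

open Literature.NumberTheory.EllipticCurves Literature.NumberTheory.EllipticCurves.ModularForms
open CongruenceSubgroup

namespace Summit.BirchSwinnertonDyer.Rank1Residual.Supersingular.KuriharaTwist

/-! ### §1 The rounding lemma (pure arithmetic) -/

section Rounding

/-- A non-zero rational is at least `1/den` in absolute value: `|y| = |num y|/den y ≥ 1/den y`. [folklore] -/
theorem one_div_den_le_abs {y : ℚ} (hy : y ≠ 0) : (1 : ℚ) / y.den ≤ |y| := by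
  have hnum : (1 : ℚ) ≤ |(y.num : ℚ)| := by
    have h1 : (1 : ℤ) ≤ |y.num| := Int.one_le_abs (Rat.num_ne_zero.mpr hy)
    exact_mod_cast h1
  have hden : (0 : ℚ) < y.den := by exact_mod_cast y.den_pos
  calc (1 : ℚ) / y.den ≤ |(y.num : ℚ)| / y.den := by gcongr
    _ = |y| := by
      conv_rhs => rw [← Rat.num_div_den y]
      rw [abs_div, Nat.abs_cast]

/-- The denominator of `D·x − J` (`D ∈ ℕ`, `J ∈ ℤ`) divides the denominator of `x`. [folklore] -/
theorem den_natCast_mul_sub_intCast_dvd (x : ℚ) (D : ℕ) (J : ℤ) :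
    ((D : ℚ) * x - J).den ∣ x.den := by
  have h : (D : ℚ) * x - J = (((D : ℤ) * x.num - J * x.den : ℤ) : ℚ) / (x.den : ℤ) := by
    have hden : (x.den : ℚ) ≠ 0 := by exact_mod_cast x.den_ne_zero
    conv_lhs => rw [← Rat.num_div_den x]
    push_cast
    field_simp
  rw [h]
  have := Rat.den_dvd ((D : ℤ) * x.num - J * x.den) (x.den : ℤ)
  rw [Rat.divInt_eq_div] at this
  exact Int.natCast_dvd_natCast.mp this

/-- **ROUNDING LEMMA.** If the rational `x` has `den x ≤ M` and `|D·x − J| < 1/M` for a natural `D` and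
an integer `J`, then `D·x = J` exactly: `D·x − J` has denominator dividing `den x`, hence `≤ M`, so if
non-zero it is at least `1/M` in absolute value. [folklore] -/
theorem mul_eq_of_abs_sub_lt {x : ℚ} {M : ℕ} (hden : x.den ≤ M) {D : ℕ} {J : ℤ}
    (h : |(D : ℚ) * x - J| < 1 / M) : (D : ℚ) * x = J := by
  by_contra hne
  have hy : (D : ℚ) * x - J ≠ 0 := sub_ne_zero.mpr hne
  have h1 := one_div_den_le_abs hy
  have hdvd : ((D : ℚ) * x - J).den ∣ x.den := den_natCast_mul_sub_intCast_dvd x D J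
  have hle : (((D : ℚ) * x - J).den : ℚ) ≤ M := by
    exact_mod_cast (Nat.le_of_dvd x.den_pos hdvd).trans hden
  have hpos : (0 : ℚ) < ((D : ℚ) * x - J).den := by exact_mod_cast Rat.den_pos _
  have h2 : (1 : ℚ) / M ≤ 1 / ((D : ℚ) * x - J).den := one_div_le_one_div_of_le hpos hle
  linarith

/-- … hence `x = J / D` when `D > 0`. [folklore] -/
theorem eq_div_of_abs_sub_lt {x : ℚ} {M : ℕ} (hden : x.den ≤ M) {D : ℕ} (hD : 0 < D)
    {J : ℤ} (h : |(D : ℚ) * x - J| < 1 / M) : x = J / D := by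
  have hmul := mul_eq_of_abs_sub_lt hden h
  have hD' : (D : ℚ) ≠ 0 := by exact_mod_cast hD.ne'
  field_simp
  linarith

/-- **The ball form of the hypothesis.** A ball `|D·x − mid| ≤ rad` (real midpoint and radius, as produced
by ball arithmetic), an integer `J` with `|mid − J| ≤ mar`, and `M·(mar + rad) < 1` give `|D·x − J| < 1/M`.
[folklore] -/
theorem abs_sub_lt_of_ball {x : ℚ} {D M : ℕ} (hM : 0 < M) {J : ℤ} {mid rad mar : ℝ}
    (hball : |(D : ℝ) * x - mid| ≤ rad) (hmar : |mid - J| ≤ mar) (hlt : (M : ℝ) * (mar + rad) < 1) :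
    |(D : ℚ) * x - J| < 1 / M := by
  have hM' : (0 : ℝ) < M := by exact_mod_cast hM
  have htri : |(D : ℝ) * x - J| ≤ rad + mar := by
    calc |(D : ℝ) * x - J| = |((D : ℝ) * x - mid) + (mid - J)| := by ring_nf
      _ ≤ |(D : ℝ) * x - mid| + |mid - J| := abs_add_le _ _
      _ ≤ rad + mar := add_le_add hball hmar
  have hreal : |(D : ℝ) * x - J| < 1 / M := by
    rw [lt_div_iff₀ hM']
    nlinarith [abs_nonneg ((D : ℝ) * x - J)]
  have key : ((|(D : ℚ) * x - J| : ℚ) : ℝ) < ((1 / M : ℚ) : ℝ) := by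
    push_cast
    exact hreal
  exact_mod_cast key

end Rounding

/-! ### §2 Denominators of `ℤ`-linear combinations of the symbols `[a/n]⁺_f`, `gcd(n, N) = 1` -/

section Integrality

variable {N : ℕ} [NeZero N] (f : CuspForm (Gamma0 N) 2)

/-- **`Σ_i w_i [a_i/n]⁺_f ∈ (2n₀)⁻¹ℤ`** for a real-coefficient `f ∈ S₂(Γ₀(N))`, an Eisenstein multiple
`n₀{∞,0}_f ∈ Λ_f` (`n₀ ≠ 0`) and `gcd(n, N) = 1`: each cusp `a_i/n` has denominator prime to `N`
(`coprime_den_of_coprime`), so `[a_i/n]⁺_f = k_i/(2n₀)` (`exists_ratPlusSymbol_eq_div_two`: Manin's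
`{∞,a/n} ≡ {∞,0} (mod Λ_f)` and `re Λ_f = (Ω⁺_f/2)ℤ`; Cremona 1997 §2.8), and `ℤ`-linear combinations
stay in `(2n₀)⁻¹ℤ`. [folklore] -/
theorem exists_sum_ratPlusSymbol_eq_div (hreal : ∀ m, (cuspCoeff f m).im = 0) {n₀ : ℤ} (hn₀ : n₀ ≠ 0)
    (h0 : (n₀ : ℂ) * modularSymbol f 0 ∈ periodLattice f) {n : ℕ} (hn : Nat.Coprime n N)
    {ι : Type*} (S : Finset ι) (w a : ι → ℤ) :
    ∃ K : ℤ, ∑ i ∈ S, (w i : ℚ) * ratPlusSymbol f ((a i : ℚ) / n) = (K : ℚ) / (2 * n₀) := by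
  classical
  induction S using Finset.induction_on with
  | empty => exact ⟨0, by simp⟩
  | @insert i S hi ih =>
    obtain ⟨K, hK⟩ := ih
    obtain ⟨k, hk⟩ :=
      exists_ratPlusSymbol_eq_div_two f hreal hn₀ h0 (coprime_den_of_coprime hn (a i))
    refine ⟨w i * k + K, ?_⟩
    rw [Finset.sum_insert hi, hK, hk]
    have hn₀' : (n₀ : ℚ) ≠ 0 := by exact_mod_cast hn₀
    push_cast
    field_simp

/-- **`den(Σ_i w_i [a_i/n]⁺_f) ∣ 2|n₀|`** under the hypotheses of `exists_sum_ratPlusSymbol_eq_div`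
(`den(K/(2n₀)) ∣ 2n₀`, `Rat.den_dvd`). [folklore] -/
theorem den_sum_ratPlusSymbol_dvd (hreal : ∀ m, (cuspCoeff f m).im = 0) {n₀ : ℤ} (hn₀ : n₀ ≠ 0)
    (h0 : (n₀ : ℂ) * modularSymbol f 0 ∈ periodLattice f) {n : ℕ} (hn : Nat.Coprime n N)
    {ι : Type*} (S : Finset ι) (w a : ι → ℤ) :
    (∑ i ∈ S, (w i : ℚ) * ratPlusSymbol f ((a i : ℚ) / n)).den ∣ (2 * n₀).natAbs := by
  obtain ⟨K, hK⟩ := exists_sum_ratPlusSymbol_eq_div f hreal hn₀ h0 hn S w a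
  rw [hK]
  have h := Rat.den_dvd K (2 * n₀)
  rw [Rat.divInt_eq_div] at h
  push_cast at h
  exact Int.natCast_dvd.mp h

end Integrality

/-! ### §3 The newform of an elliptic curve: `den ∣ 2·#Ẽ(𝔽_ℓ)` at any good prime `ℓ`, Hasse, and the
certificate's soundness -/

section EllipticCurve

variable {N : ℕ} [NeZero N] {f : CuspForm (Gamma0 N) 2}
  {W : WeierstrassCurve ℚ} [W.IsElliptic] [W.IsGloballyMinimal]

/-- **The Eisenstein multiple at a good prime `ℓ`, for the newform of `E = W`**:
`(−#Ẽ(𝔽_ℓ))·{∞,0}_f ∈ Λ_f`, since `a_ℓ(f) − ℓ − 1 = a_ℓ(E) − ℓ − 1 = −#Ẽ(𝔽_ℓ)`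
(`sub_mul_modularSymbol_zero_mem_periodLattice` = Cremona 1997 (2.8.8) `(1+p−a_p)·⟨{0,∞},f⟩ = Σ_k ⟨{0,k/p},f⟩`;
`cuspCoeff_eq_frobeniusTrace_of_isNewformOf_holds`; `ℓ ∤ N` by `not_dvd_level_of_isNewformOf`; the tree's
`frobeniusTrace W ℓ = ℓ + 1 − reductionPointCount W ℓ`). [cite: CremonaAlgorithms1997, §2.8 (2.8.8) (PDF p. 26)] -/
theorem neg_reductionPointCount_mul_modularSymbol_zero_mem (hf : IsNewformOf W f) {ℓ : ℕ} [Fact ℓ.Prime]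
    (hgood : W.HasGoodReductionAtPrime ℓ) :
    ((-(W.reductionPointCount ℓ : ℤ) : ℤ) : ℂ) * modularSymbol f 0 ∈ periodLattice f := by
  have hℓN : ¬ ℓ ∣ N := not_dvd_level_of_isNewformOf hf hgood
  have hap : cuspCoeff f ℓ = ((W.frobeniusTrace ℓ : ℤ) : ℂ) :=
    cuspCoeff_eq_frobeniusTrace_of_isNewformOf_holds hf hgood
  have h := sub_mul_modularSymbol_zero_mem_periodLattice hf.1 (Fact.out : ℓ.Prime) hℓN
  have hap' : cuspCoeff f ℓ - ℓ - 1 = ((-(W.reductionPointCount ℓ : ℤ) : ℤ) : ℂ) := by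
    rw [hap, WeierstrassCurve.frobeniusTrace]
    push_cast
    ring
  rwa [hap'] at h

/-- **`den(Σ_i w_i [a_i/n]⁺_f) ∣ 2·#Ẽ(𝔽_ℓ)`** for the newform `f` of `E = W`, ANY prime `ℓ` of good
reduction and `gcd(n, N) = 1` — the DENOMINATOR LEMMA of the rounding certificates in `f`-units: no Manin
constant, no `#E(ℚ)_tors`, no optimality code (`den_sum_ratPlusSymbol_dvd` with `n₀ = −#Ẽ(𝔽_ℓ) ≠ 0`,
`reductionPointCount_pos`; real coefficients by `IsNewform0.cuspCoeff_im_eq_zero`).  For `ℓ = p` good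
supersingular, `p ≥ 5`, this is `den ∣ 2(p + 1)`. [cite: CremonaAlgorithms1997, §2.8 (2.8.8) (PDF p. 26)] -/
theorem den_sum_ratPlusSymbol_dvd_two_mul_reductionPointCount (hf : IsNewformOf W f) {ℓ : ℕ}
    [Fact ℓ.Prime] (hgood : W.HasGoodReductionAtPrime ℓ) {n : ℕ} (hn : Nat.Coprime n N)
    {ι : Type*} (S : Finset ι) (w a : ι → ℤ) :
    (∑ i ∈ S, (w i : ℚ) * ratPlusSymbol f ((a i : ℚ) / n)).den ∣ 2 * W.reductionPointCount ℓ := by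
  have hc : (W.reductionPointCount ℓ : ℤ) ≠ 0 := by exact_mod_cast (W.reductionPointCount_pos ℓ).ne'
  have h := den_sum_ratPlusSymbol_dvd f hf.1.cuspCoeff_im_eq_zero (neg_ne_zero.mpr hc)
    (neg_reductionPointCount_mul_modularSymbol_zero_mem hf hgood) hn S w a
  simpa [Int.natAbs_mul, Int.natAbs_neg] using h

variable (W) in
/-- **Hasse: `#Ẽ(𝔽_ℓ) ≤ 4ℓ`** at a prime of good reduction (`(ℓ + 1 − #Ẽ(𝔽_ℓ))² = a_ℓ² ≤ 4ℓ`,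
`frobeniusTrace_sq_le_four_mul`; `#Ẽ(𝔽_ℓ) ≤ ℓ + 1 + 2√ℓ ≤ 4ℓ` for `ℓ ≥ 2`). [cite: SilvermanAEC2009, Thm. V.1.1] -/
theorem reductionPointCount_le_four_mul (ℓ : ℕ) [Fact ℓ.Prime] (hgood : W.HasGoodReductionAtPrime ℓ) :
    W.reductionPointCount ℓ ≤ 4 * ℓ := by
  have h := W.frobeniusTrace_sq_le_four_mul ℓ hgood
  unfold WeierstrassCurve.frobeniusTrace at h
  by_contra hlt
  rw [not_le] at hlt
  have hc : (4 * ℓ : ℤ) + 1 ≤ W.reductionPointCount ℓ := by exact_mod_cast hlt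
  have hℓ : (2 : ℤ) ≤ ℓ := by exact_mod_cast (Fact.out : ℓ.Prime).two_le
  have h1 : 3 * (ℓ : ℤ) ≤ (W.reductionPointCount ℓ : ℤ) - ℓ - 1 := by linarith
  have h2 : (3 * (ℓ : ℤ)) ^ 2 ≤ ((W.reductionPointCount ℓ : ℤ) - ℓ - 1) ^ 2 :=
    pow_le_pow_left₀ (by positivity) h1 2
  have h3 : ((ℓ : ℤ) + 1 - W.reductionPointCount ℓ) ^ 2 = ((W.reductionPointCount ℓ : ℤ) - ℓ - 1) ^ 2 := by
    ring
  nlinarith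

/-- **`den(Σ_i w_i [a_i/n]⁺_f) ≤ 8ℓ`** for the newform of `E = W`, a good prime `ℓ` and `gcd(n, N) = 1`
(`den ∣ 2#Ẽ(𝔽_ℓ) ≤ 8ℓ`). [folklore] -/
theorem den_sum_ratPlusSymbol_le (hf : IsNewformOf W f) {ℓ : ℕ} [Fact ℓ.Prime]
    (hgood : W.HasGoodReductionAtPrime ℓ) {n : ℕ} (hn : Nat.Coprime n N)
    {ι : Type*} (S : Finset ι) (w a : ι → ℤ) :
    (∑ i ∈ S, (w i : ℚ) * ratPlusSymbol f ((a i : ℚ) / n)).den ≤ 8 * ℓ := by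
  have hpos : 0 < 2 * W.reductionPointCount ℓ := by
    have := W.reductionPointCount_pos ℓ
    omega
  exact (Nat.le_of_dvd hpos (den_sum_ratPlusSymbol_dvd_two_mul_reductionPointCount hf hgood hn S w a)).trans
    (by have := reductionPointCount_le_four_mul W ℓ hgood; omega)

/-- **SOUNDNESS OF A ROUNDING CERTIFICATE (`f`-units).**  Let `f` be the newform of `E = W`, `ℓ` a prime of
good reduction, `gcd(n, N) = 1`, and `x = Σ_i w_i [a_i/n]⁺_f` (a bin, or an integer combination of bins, of
the plus symbols at a Kurihara level `n`).  If ball arithmetic encloses `D·x` in `mid ± rad` (`D ≥ 1` an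
integer scale), `J` is an integer with `|mid − J| ≤ mar`, and the HASSE-BOUNDED CERTIFICATE INEQUALITY
`8ℓ·(mar + rad) < 1` holds, then `x = J/D` EXACTLY: `|D·x − J| ≤ mar + rad < 1/(8ℓ)` while `den x ≤ 8ℓ`
(`eq_div_of_abs_sub_lt`, `abs_sub_lt_of_ball`, `den_sum_ratPlusSymbol_le`).  Nothing about a Manin
constant, `#E(ℚ)_tors` or optimality is used; the only inputs outside the kernel are the ball and the
identification of the engine's real number with `D·x` (module docstring, (a)–(b)).
[cite: CremonaAlgorithms1997, §2.8 (2.8.8) (PDF p. 26)] -/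
theorem sum_ratPlusSymbol_eq_div_of_ball (hf : IsNewformOf W f) {ℓ : ℕ} [Fact ℓ.Prime]
    (hgood : W.HasGoodReductionAtPrime ℓ) {n : ℕ} (hn : Nat.Coprime n N) {ι : Type*} (S : Finset ι)
    (w a : ι → ℤ) {D : ℕ} (hD : 0 < D) {J : ℤ} {mid rad mar : ℝ}
    (hball : |(D : ℝ) * ((∑ i ∈ S, (w i : ℚ) * ratPlusSymbol f ((a i : ℚ) / n) : ℚ) : ℝ) - mid| ≤ rad)
    (hmar : |mid - J| ≤ mar) (hcert : 8 * (ℓ : ℝ) * (mar + rad) < 1) :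
    ∑ i ∈ S, (w i : ℚ) * ratPlusSymbol f ((a i : ℚ) / n) = J / D := by
  have hM : 0 < 8 * ℓ := by have := (Fact.out : ℓ.Prime).pos; omega
  have hlt : ((8 * ℓ : ℕ) : ℝ) * (mar + rad) < 1 := by push_cast; exact hcert
  exact eq_div_of_abs_sub_lt (den_sum_ratPlusSymbol_le hf hgood hn S w a) hD
    (abs_sub_lt_of_ball hM hball hmar hlt)

end EllipticCurve

/-! ### §4 Reading a `RoundingCert` row in this currency (theorems only; the decidable check
`RoundingCert.validHasse` is the sibling `KuriharaTwistRoundingHasseCheck.lean`) -/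

section Row

/-- The cleared integer inequality `8·p·(marNum·10^radExp + radNum·10^marExp) < 10^(marExp+radExp)` of a row,
in real form: `8p·(marNum/10^marExp + radNum/10^radExp) < 1` — the hypothesis `hcert` of
`sum_ratPlusSymbol_eq_div_of_ball` with `ℓ = p`, `mar = marNum/10^marExp`, `rad = radNum/10^radExp`. [folklore] -/
theorem RoundingCert.hcert_of_ineq (c : RoundingCert)
    (hi : 8 * c.p * (c.marNum * 10 ^ c.radExp + c.radNum * 10 ^ c.marExp) < 10 ^ (c.marExp + c.radExp)) :
    8 * (c.p : ℝ) * ((c.marNum : ℝ) / 10 ^ c.marExp + (c.radNum : ℝ) / 10 ^ c.radExp) < 1 := by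
  have hm : (0 : ℝ) < 10 ^ c.marExp := by positivity
  have hr : (0 : ℝ) < 10 ^ c.radExp := by positivity
  have hi' : 8 * (c.p : ℝ) * ((c.marNum : ℝ) * 10 ^ c.radExp + (c.radNum : ℝ) * 10 ^ c.marExp) <
      10 ^ c.marExp * 10 ^ c.radExp := by
    rw [← pow_add]; exact_mod_cast hi
  rw [div_add_div _ _ hm.ne' hr.ne', ← mul_div_assoc, div_lt_one (mul_pos hm hr)]
  have hcomm : ((c.marNum : ℝ) * 10 ^ c.radExp + 10 ^ c.marExp * (c.radNum : ℝ)) =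
      (c.marNum : ℝ) * 10 ^ c.radExp + (c.radNum : ℝ) * 10 ^ c.marExp := by ring
  rw [hcomm]
  exact hi'

variable {N : ℕ} [NeZero N] {f : CuspForm (Gamma0 N) 2}
  {W : WeierstrassCurve ℚ} [W.IsElliptic] [W.IsGloballyMinimal]

/-- **A ROW WITH THE HASSE-BOUNDED INEQUALITY CERTIFIES EXACT ROUNDING (schema-level soundness).**  For a
`RoundingCert` row `c` whose recorded decimal bounds satisfy
`8·p·(marNum·10^radExp + radNum·10^marExp) < 10^(marExp+radExp)` (every landed row does, module docstring;
the decidable form is `validHasse` in the sibling file), the newform `f` of a curve `E = W` with good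
reduction at `c.p`, `gcd(n, N) = 1`, any `ℤ`-combination `x = Σ_i w_i [a_i/n]⁺_f`, any integer scale `D ≥ 1`
and integer `J`: if the engine's ball `mid ± rad` encloses `D·x` with `rad ≤ radNum/10^radExp` and
`|mid − J| ≤ marNum/10^marExp` (the row's recorded upper bounds), then `x = J/D`.  Used with
`D = dstar·c_∞` (or `dstar`), `J = binsStar[k]`, `x` = the `k`-th bin: the recorded integer bins are the
exact values (module docstring (a)–(b) for what the ball hypothesis carries); the fields `torsion`, `manin`,
`optimality` are not read. [cite: CremonaAlgorithms1997, §2.8 (2.8.8) (PDF p. 26)] -/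
theorem RoundingCert.sum_ratPlusSymbol_eq_div_of_ineq (c : RoundingCert)
    (hi : 8 * c.p * (c.marNum * 10 ^ c.radExp + c.radNum * 10 ^ c.marExp) < 10 ^ (c.marExp + c.radExp))
    [Fact c.p.Prime] (hf : IsNewformOf W f) (hgood : W.HasGoodReductionAtPrime c.p) {n : ℕ}
    (hn : Nat.Coprime n N) {ι : Type*} (S : Finset ι) (w a : ι → ℤ) {D : ℕ} (hD : 0 < D) {J : ℤ}
    {mid rad : ℝ}
    (hball : |(D : ℝ) * ((∑ i ∈ S, (w i : ℚ) * ratPlusSymbol f ((a i : ℚ) / n) : ℚ) : ℝ) - mid| ≤ rad)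
    (hrad : rad ≤ (c.radNum : ℝ) / 10 ^ c.radExp) (hmar : |mid - J| ≤ (c.marNum : ℝ) / 10 ^ c.marExp) :
    ∑ i ∈ S, (w i : ℚ) * ratPlusSymbol f ((a i : ℚ) / n) = J / D :=
  sum_ratPlusSymbol_eq_div_of_ball hf hgood hn S w a hD (hball.trans hrad) hmar (c.hcert_of_ineq hi)

/-- The schema SAMPLE row (`43314b1` @ `5`, `n = 10291`, `D' = 4`, margin `≤ 6.85·10⁻²⁰`, radius
`≤ 6.55·10⁻¹²`) satisfies the Hasse-bounded inequality `40·(6.85·10⁻²⁰ + 6.55·10⁻¹²) < 1` (cleared form,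
re-checked by the kernel). [folklore] -/
theorem ineq_sample : 8 * 5 * (685 * 10 ^ 14 + 655 * 10 ^ 22) < 10 ^ (22 + 14) := by norm_num

end Row

end Summit.BirchSwinnertonDyer.Rank1Residual.Supersingular.KuriharaTwist
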